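import Summits.QuantumFields.YangMills.Theorems.BalabanUVNodesN15PerCubeGreenKnitClose
import Summits.QuantumFields.YangMills.Theorems.BalabanUVNodesN15PerCubeGreenDictionary
import HarnessLib

/-!
# N15 = NE2, road (c) — PROGRAMME (PC), towards (PC-B): THE COVARIANT KNIT AGAINST THE FLAT KNIT — a `U(m)` field (3.35)-small in the TRIVIAL gauge near, in Bałaban's class far;
# gauges `1` near ⟹ `G′(U) − G′(𝟙) = mulVecLin (cGreen (cvT e U) a) − mulVecLin (cGreen (cvT e 𝟙) a) ≤ B·(r_V(1+|J⊕J|) + R_N + (L^m)⁻¹ + e^{−(3δ∕128)d_Z(y)})·e^{−(δ∕64)d}` (dag-n15-c g27, n15-c∕296)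

Cell `pub-ymgap`, seat `pub-ymgap-dag-n15-c` (generation g27; R134 (a), s1; HUMAN RULING D-0062).  `bears_on: R4∕N15 · K3⁸ SpineGivenEndpointR13SepCoPHV (stmt-QuantumFields-27366)`;
filed `--kind proof --supports stmt-QuantumFields-27366 --as helper` — COUNT-NEUTRAL.  0 `def`, 0 `sorry`.  Imports n15-c∕295 `…PerCubeGreenKnitClose` (`uN_scGlued_sub_scGlued_spec`) and
n15-c∕266 `…PerCubeGreenDictionary` (`covLapM_add_scP_eq_mulVecLin_claplA`, `eq_mulVecLin_cGreen_of_comp_eq_id`, `isUnit_cvT`; through it n15-c∕265 `…PerCubeGreenCovariant`: its objects `scP`, `scNV`, identities `scP_conj`, `one_sub_scPsi_comp_scNV_comp_scChi`, cut row `hasMaj_scNV_cut_of_rows`, `scChi_ne_zero_nbhd`;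
dag-n15-w2 `uN_exists_gauge_cutCoefLetters_of_reg335Cube`, `uN_localCoefLetters_of_gauge335`; r06 `Reg335Cube`, (3.28) `gaugeTr`, `fluct`).  Nothing in the tree is modified.

WHY ((PC-B), [B9] (3.95)–(3.96) p.411).  In the defect of cube `□` of the flat-model expansion of `(Q′G′²Q′ᵀ)⁻¹(U)`, `U` is read in a gauge `w_□` regular on the doubled walk cube: there
`U^{w_□}` is (3.35)-small in the TRIVIAL gauge; away from it `U^{w_□}` is only in the per-cube class.  This file compares the knit of such a field with the flat knit (`U ≡ 𝟙`, gauges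
`𝟙`): `Far` = the cubes whose boxes leave the doubled walk cube, `Z ⊇` their regions; the bound is the data's own size near `□` plus the partition letter `(L^m)⁻¹` plus the walk tail.

HONEST FRAMING ∕ LIMITS.  MODEL carriers; no propagator of record estimated; [B9] cited for SHAPES ∕ MECHANISM.  NE2⁺ NOT PRINTED, NOT proved; N15 of record untouched; K3⁸ OPEN;
counts UNMOVED.  Restate-immune (no Theses import).
-/

noncomputable section

open scoped BigOperators Matrix Matrix.Norms.L2Operator

namespace Summit.QuantumFields.YangMills.BalabanUVNodes.N15.Gluing

open Real
open Literature.MathematicalPhysics.QuantumFieldTheory.Balaban1983to89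
open Literature.MathematicalPhysics.QuantumFieldTheory.Balaban1983to89.B5Prop11Plancherel (Tor fine unitVec)
open Literature.MathematicalPhysics.QuantumFieldTheory.Balaban1983to89.B11SectG (BlockNorm HasMaj hasMaj_zero)
open Literature.MathematicalPhysics.QuantumFieldTheory.Balaban1983to89.B6Prop26Gluing (mulOp)
open Literature.MathematicalPhysics.QuantumFieldTheory.Balaban1983to89.B6UnitTorusCarrier (unitTorusGeo)
open Literature.MathematicalPhysics.QuantumFieldTheory.Balaban1983to89.B9Eq335RegularityClasses (Reg335Cube)
open Literature.MathematicalPhysics.QuantumFieldTheory.Balaban1983to89.B9Eq3117Current (gaugeTr gaugeTr_apply)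
open Literature.MathematicalPhysics.QuantumFieldTheory.Balaban1983to89.B9Eq39Adjoint (covD fluct)
open Literature.MathematicalPhysics.QuantumFieldTheory.Balaban1983to89.B9BackgroundsKLevelV1 (fluct_zero)
open Summit.QuantumFields.YangMills.BalabanUVNodes.N15.CovLandau (claplA cGreen)
open Literature.MathematicalPhysics.QuantumFieldTheory.King1986 (aK aK_pos aK_le)
open Literature.MathematicalPhysics.QuantumFieldTheory.King1986.Torus (blockOf)
open Literature.Barriers.QuantumFields (traceForm)
open Summit.QuantumFields.YangMills.BalabanUVNodes.N15.BackgroundLayer (covLapM tCoefA tCoefC)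
open Summit.QuantumFields.YangMills.BalabanUVNodes.N15.VectorPiece (bshiftEquiv bshiftEquiv_apply)
open Summit.QuantumFields.YangMills.BalabanUVNodes.N15.MatrixSpecies (mmulOp coordMat basisConst liftEquiv)
open Summit.QuantumFields.YangMills.BalabanUVNodes.N15.TwoGrid (chiCube cubeBlocks)
open Summit.QuantumFields.YangMills.BalabanUVNodes.N15.CurvedSpecies (gaugePair uN_exists_gauge_cutCoefLetters_of_reg335Cube uN_localCoefLetters_of_gauge335)

variable {d : ℕ}

section Green

variable {L : ℕ} [NeZero L]

set_option maxHeartbeats 400000 in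

/-- ★★★ **WALK LOCALITY OF THE COVARIANT GREEN's FUNCTION KNIT AGAINST THE FLAT KNIT, FROM (3.35) DATA: the knit of a `U(m)` bond field `U` that is (3.35)-small IN THE TRIVIAL GAUGE on the
boxes of the cubes NOT in `Far` (and in Bałaban's per-cube class (3.35) on the boxes of the far cubes) differs from the knit of the flat field `U ≡ 1` (all gauges `1`) by
`B·(r_V(1 + |J ⊕ J|) + R_N(r_V) + (L^m)⁻¹ + e^{−(3δ∕128)d_Z(y)})·e^{−(δ∕64)|y−y′|_T}` blockwise, `R_N(r_V) = a_K·|ι|(|ι|σ² + 2σ)`, `σ = (1 + r_VL^{−k})^{(d+1)L^k} − 1`.**  The site gauges of the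
first knit are `1` on the near cubes and the class's gauges (extended by `1`) on the far ones (dag-n15-w2 `uN_exists_gauge_cutCoefLetters_of_reg335Cube`); the letters of both families
are dag-n15-w2 `uN_localCoefLetters_of_gauge335` (trivial datum `u = 1`, and `A = 0` for the flat field); n15-c∕265's summand identity `scP_conj`, cut row `hasMaj_scNV_cut_of_rows` and
VANISHING far row; then n15-c∕295 `uN_scGlued_sub_scGlued_spec` with `θ_F = 0`, and both knits ARE the named Green's functions by n15-c∕262's inverse identities + n15-c∕266's dictionary
(`covLapM_add_scP_eq_mulVecLin_claplA`, `eq_mulVecLin_cGreen_of_comp_eq_id`; `cvT_one`: the flat knit is `G′(𝟙)`).  MODEL carriers; the SHAPE of [B9] Cor. 3.8 for the (3.95) defect, NOT the printed corollary.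
[cite: Balaban1985BackgroundPropagators, Cor. 3.8 p.410, (3.95)–(3.96) p.411, (3.34)–(3.35) p.396, Thm 3.7 (3.90) p.409 (shape ∕ mechanism); Balaban1984PropagatorsII, (2.91)–(2.93) p.239] -/
theorem hasMaj_cGreen_sub_cGreen_one_of_reg335 (hL : Odd L ∧ 1 < L) (hL7 : 7 ≤ L) {a₀ : ℝ} (ha₀ : 0 < a₀) (ι : Type) [Fintype ι] [DecidableEq ι] :
    ∃ δ w₀ R₀ B : ℝ, 0 < δ ∧ 0 < R₀ ∧ 0 < B ∧
      ∀ (mv kk : ℕ), 1 ≤ kk → w₀ ≤ ((L ^ mv : ℕ) : ℝ) →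
      ∀ {mm : Type} [Fintype mm] [DecidableEq mm] [Nonempty mm] (e : Matrix mm mm ℂ ≃L[ℝ] (ι → ℝ)), (∀ A B : Matrix mm mm ℂ, traceForm A B = e A ⬝ᵥ e B) →
      ∀ (Far : (Fin (d + 1) → ZMod (2 * L)) → Prop) [DecidablePred Far] (Z : Set (Tor (cvM d L mv kk hL))) (dZ : Tor (cvM d L mv kk hL) → ℝ),
        (∀ y z, z ∈ Z → dZ y ≤ (unitTorusGeo L kk (cvM d L mv kk hL)).dist y z) → (∀ y, 0 ≤ dZ y) → (∀ k, Far k → cvSk d L mv kk hL k ⊆ Z) →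
      ∀ (U : Fin (d + 1) → ScX d L mv kk hL → (Matrix mm mm ℂ)ˣ), (∀ μ x, (U μ x : Matrix mm mm ℂ) ∈ Matrix.unitaryGroup mm ℂ) →
      ∀ (ξ C : ℝ), 0 < ξ → 0 < C →
        (∀ k, Far k → Reg335Cube (scShift d L mv kk hL) U ((((L ^ kk : ℕ) : ℝ))⁻¹) {x : ScX d L mv kk hL | blockOf (L ^ kk) (cvM d L mv kk hL) x ∈ cubeBlocks (cvM d L mv kk hL) (coverCorner (cvM d L mv kk hL) (L ^ mv) L (2 * L ^ mv + 1) k) (6 * L ^ mv + 3)} ξ C) →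
        (∀ k, ¬Far k → ∃ A : Fin (d + 1) → ScX d L mv kk hL → Matrix mm mm ℂ, (∀ μ, ∀ z ∈ {x : ScX d L mv kk hL | blockOf (L ^ kk) (cvM d L mv kk hL) x ∈ cubeBlocks (cvM d L mv kk hL) (coverCorner (cvM d L mv kk hL) (L ^ mv) L (2 * L ^ mv + 1) k) (6 * L ^ mv + 3)}, gaugeTr (scShift d L mv kk hL) (fun _ => (1 : (Matrix mm mm ℂ)ˣ)) U μ z = fluct ((((L ^ kk : ℕ) : ℝ))⁻¹) A μ z) ∧
          (∀ μ, ∀ z ∈ {x : ScX d L mv kk hL | blockOf (L ^ kk) (cvM d L mv kk hL) x ∈ cubeBlocks (cvM d L mv kk hL) (coverCorner (cvM d L mv kk hL) (L ^ mv) L (2 * L ^ mv + 1) k) (6 * L ^ mv + 3)}, ‖A μ z‖ < C * ξ⁻¹) ∧ (∀ μ ν, ∀ z ∈ {x : ScX d L mv kk hL | blockOf (L ^ kk) (cvM d L mv kk hL) x ∈ cubeBlocks (cvM d L mv kk hL) (coverCorner (cvM d L mv kk hL) (L ^ mv) L (2 * L ^ mv + 1) k) (6 * L ^ mv + 3)},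 ‖((↑((((L ^ kk : ℕ) : ℝ))⁻¹) : ℂ)⁻¹) • covD (scShift d L mv kk hL) (fun _ _ => (1 : (Matrix mm mm ℂ)ˣ)) μ (A ν) z‖ < C * (ξ ^ 2)⁻¹)) →
      ∀ (rV : ℝ), 0 ≤ rV →
        Fintype.card ι * (@basisConst ι _ (Matrix mm mm ℂ) Matrix.frobeniusNormedAddCommGroup Matrix.frobeniusNormedSpace e * (2 * Real.sqrt (Fintype.card mm)) * (Real.sqrt (Fintype.card mm) * ((C / ξ) * Real.exp (((((L ^ kk : ℕ) : ℝ))⁻¹) * (C / ξ))))) ≤ rV →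
        Fintype.card ι * (Fintype.card (Fin (d + 1)) * (Fintype.card ι * (@basisConst ι _ (Matrix mm mm ℂ) Matrix.frobeniusNormedAddCommGroup Matrix.frobeniusNormedSpace e * (2 * Real.sqrt (Fintype.card mm)) * (Real.sqrt (Fintype.card mm) * ((C / ξ) * Real.exp (((((L ^ kk : ℕ) : ℝ))⁻¹) * (C / ξ))))) ^ 2 + @basisConst ι _ (Matrix mm mm ℂ) Matrix.frobeniusNormedAddCommGroup Matrix.frobeniusNormedSpace e * (2 * Real.sqrt (Fintype.card mm)) * (Real.sqrt (Fintype.card mm) * ((C / ξ ^ 2) * Real.exp (((((L ^ kk : ℕ) : ℝ))⁻¹) * (C / ξ)))))) ≤ rV →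
        rV * (1 + Fintype.card (Fin (d + 1) ⊕ Fin (d + 1))) + a₀ * (Fintype.card ι * (Fintype.card ι * ((1 + rV * ((((L ^ kk : ℕ) : ℝ))⁻¹)) ^ ((d + 1) * L ^ kk) - 1) ^ 2 + 2 * ((1 + rV * ((((L ^ kk : ℕ) : ℝ))⁻¹)) ^ ((d + 1) * L ^ kk) - 1))) ≤ R₀ →
        HasMaj (ScNorm d L mv kk hL ι) (ScNorm d L mv kk hL ι)
            (Matrix.mulVecLin (cGreen (cvM d L mv kk hL) (L ^ kk) (cvT e (fun μ x => (U μ x : Matrix mm mm ℂ))) (aK a₀ (L : ℝ) kk * (((L ^ kk : ℕ) : ℝ)) ^ (d + 1))) -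
              Matrix.mulVecLin (cGreen (cvM d L mv kk hL) (L ^ kk) (fun (_ : Fin (d + 1)) (_ : ScX d L mv kk hL) => (1 : Matrix ι ι ℝ)) (aK a₀ (L : ℝ) kk * (((L ^ kk : ℕ) : ℝ)) ^ (d + 1))))
          (fun y y' => B * (rV * (1 + Fintype.card (Fin (d + 1) ⊕ Fin (d + 1))) + aK a₀ (L : ℝ) kk * (Fintype.card ι * (Fintype.card ι * ((1 + rV * ((((L ^ kk : ℕ) : ℝ))⁻¹)) ^ ((d + 1) * L ^ kk) - 1) ^ 2 + 2 * ((1 + rV * ((((L ^ kk : ℕ) : ℝ))⁻¹)) ^ ((d + 1) * L ^ kk) - 1))) + (((L ^ mv : ℕ) : ℝ))⁻¹ + Real.exp (-(3 * δ / 128 * dZ y))) *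
            Real.exp (-(δ / 64 * (unitTorusGeo L kk (cvM d L mv kk hL)).dist y y'))) := by
  obtain ⟨δ, w₀, R₀, θ₀, B, hδ, hR₀, hθ₀, hB, H⟩ := uN_scGlued_sub_scGlued_spec (d := d) hL hL7 ha₀ ι
  obtain ⟨δq, w₀q, R₀q, θ₀q, Bq, hδq, hR₀q, hθ₀q, -, Hq⟩ := uN_scGlued_spec (d := d) hL hL7 ha₀ ι
  have hL1r : (1 : ℝ) < (L : ℝ) := by exact_mod_cast hL.2
  have hL3 : 3 ≤ L := by omega
  refine ⟨δ, max (max w₀ w₀q) 2, min R₀ R₀q, B, hδ, lt_min hR₀ hR₀q, hB, fun mv kk hk hw₀ => ?_⟩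
  intro mm _ _ _ e he Far _ Z dZ hdZ hdZ0 hZ U hU ξ C hξ hC hfar hnear rV hrV hrA hrC hRle
  have hw₀' : w₀ ≤ ((L ^ mv : ℕ) : ℝ) := ((le_max_left _ _).trans (le_max_left _ _)).trans hw₀
  have hw₀q : w₀q ≤ ((L ^ mv : ℕ) : ℝ) := ((le_max_right _ _).trans (le_max_left _ _)).trans hw₀
  have hW2 : 2 ≤ L ^ mv := by have h := (le_max_right (max w₀ w₀q) 2).trans hw₀; exact_mod_cast h
  have hw : 0 < L ^ mv := by omega
  have hη : (0 : ℝ) < ((((L ^ kk : ℕ) : ℝ))⁻¹) := inv_pos.mpr (Nat.cast_pos.mpr (pow_pos (Nat.pos_of_ne_zero (NeZero.ne L)) kk))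
  have hnr : (0 : ℝ) < ((L ^ kk : ℕ) : ℝ) := by exact_mod_cast pow_pos (Nat.pos_of_ne_zero (NeZero.ne L)) kk
  have hM : ∀ ν, cvM d L mv kk hL ν = 2 * L * L ^ mv := MP_succ_eq L mv kk hL
  have hm₁ : 2 * L ^ mv ≤ coverMargin L mv := two_mul_le_coverMargin hL7 mv
  have hfitI : coverMargin L mv - 2 * L ^ mv + (6 * L ^ mv + 1) ≤ L * L ^ mv := coverMargin_inner_fit hL7 hW2
  have hS0 : L * L ^ mv ≤ 2 * L * L ^ mv := by rw [mul_assoc]; omega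
  -- King's window at the index
  have haK : 0 < aK a₀ (L : ℝ) kk := aK_pos ha₀ hL1r hk
  have haKle : aK a₀ (L : ℝ) kk ≤ a₀ := aK_le ha₀ hL1r hk
  have ha' : 0 < (aK a₀ (L : ℝ) kk * (((L ^ kk : ℕ) : ℝ)) ^ (d + 1)) := by positivity
  -- the letter of the cut row
  have hσ0 : 0 ≤ ((1 + rV * ((((L ^ kk : ℕ) : ℝ))⁻¹)) ^ ((d + 1) * L ^ kk) - 1) := by
    have := one_le_pow₀ (M₀ := ℝ) (a := 1 + rV * ((((L ^ kk : ℕ) : ℝ))⁻¹)) (by nlinarith [hη.le]) (n := (d + 1) * L ^ kk); linarith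
  have hLσ0 : 0 ≤ Fintype.card ι * (Fintype.card ι * ((1 + rV * ((((L ^ kk : ℕ) : ℝ))⁻¹)) ^ ((d + 1) * L ^ kk) - 1) ^ 2 + 2 * ((1 + rV * ((((L ^ kk : ℕ) : ℝ))⁻¹)) ^ ((d + 1) * L ^ kk) - 1)) := by positivity
  have hRN0 : 0 ≤ aK a₀ (L : ℝ) kk * (Fintype.card ι * (Fintype.card ι * ((1 + rV * ((((L ^ kk : ℕ) : ℝ))⁻¹)) ^ ((d + 1) * L ^ kk) - 1) ^ 2 + 2 * ((1 + rV * ((((L ^ kk : ℕ) : ℝ))⁻¹)) ^ ((d + 1) * L ^ kk) - 1))) := by positivity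
  have hRle' : rV * (1 + Fintype.card (Fin (d + 1) ⊕ Fin (d + 1))) + aK a₀ (L : ℝ) kk * (Fintype.card ι * (Fintype.card ι * ((1 + rV * ((((L ^ kk : ℕ) : ℝ))⁻¹)) ^ ((d + 1) * L ^ kk) - 1) ^ 2 + 2 * ((1 + rV * ((((L ^ kk : ℕ) : ℝ))⁻¹)) ^ ((d + 1) * L ^ kk) - 1))) ≤ R₀ :=
    by have := mul_le_mul_of_nonneg_right haKle hLσ0; linarith [min_le_left R₀ R₀q]
  have hRleq : rV * (1 + Fintype.card (Fin (d + 1) ⊕ Fin (d + 1))) + aK a₀ (L : ℝ) kk * (Fintype.card ι * (Fintype.card ι * ((1 + rV * ((((L ^ kk : ℕ) : ℝ))⁻¹)) ^ ((d + 1) * L ^ kk) - 1) ^ 2 + 2 * ((1 + rV * ((((L ^ kk : ℕ) : ℝ))⁻¹)) ^ ((d + 1) * L ^ kk) - 1))) ≤ R₀q :=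
    by have := mul_le_mul_of_nonneg_right haKle hLσ0; linarith [min_le_right R₀ R₀q]
  have habs : |(aK a₀ (L : ℝ) kk * (((L ^ kk : ℕ) : ℝ)) ^ (d + 1))| * ((((L ^ kk : ℕ) : ℝ)) ^ (d + 1))⁻¹ = aK a₀ (L : ℝ) kk := by
    rw [abs_of_pos ha', mul_assoc, mul_inv_cancel₀ (by positivity), mul_one]
  -- the per-cube gauges and their (3.35) letters from the class on the boxes (dag-n15-w2)
  have hU' : ∀ μ x, ((U μ x : Matrix mm mm ℂ))ᴴ * (U μ x : Matrix mm mm ℂ) = 1 := fun μ x => Matrix.mem_unitaryGroup_iff'.mp (hU μ x)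
  have h1u : ∀ (μ : Fin (d + 1)) (x : ScX d L mv kk hL), (((fun (_ : Fin (d + 1)) (_ : ScX d L mv kk hL) => (1 : (Matrix mm mm ℂ)ˣ)) μ x : (Matrix mm mm ℂ)ˣ) : Matrix mm mm ℂ) ∈ Matrix.unitaryGroup mm ℂ := fun μ x => by
    simp only [Units.val_one]; exact Submonoid.one_mem _
  have hone : ∀ z : ScX d L mv kk hL, ‖(((fun (_ : ScX d L mv kk hL) => (1 : (Matrix mm mm ℂ)ˣ)) z : (Matrix mm mm ℂ)ˣ) : Matrix mm mm ℂ)‖ ≤ 1 ∧ ‖((((fun (_ : ScX d L mv kk hL) => (1 : (Matrix mm mm ℂ)ˣ)) z)⁻¹ : (Matrix mm mm ℂ)ˣ) : Matrix mm mm ℂ)‖ ≤ 1 :=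
    fun z => by simp only [Units.val_one, inv_one]; exact ⟨norm_one.le, norm_one.le⟩
  -- FAR cubes: the class's gauge extended by `1`, and its letters (dag-n15-w2)
  have hfarW : ∀ k, Far k → ∃ w : ScX d L mv kk hL → Matrix mm mm ℂ, (∀ y, (w y)ᴴ * w y = 1) ∧ (∀ x, scChi d L mv kk hL k x ≠ 0 → ∀ i, ∑ j, |tCoefC ((((L ^ kk : ℕ) : ℝ))⁻¹) (gaugePair (scShift d L mv kk hL) fun μ y => coordMat e (ContinuousLinearMap.mulLeftRight ℝ (Matrix mm mm ℂ) (w y * (U μ y : Matrix mm mm ℂ) * (w (scShift d L mv kk hL μ y))ᴴ) (w y * (U μ y : Matrix mm mm ℂ) * (w (scShift d L mv kk hL μ y))ᴴ)ᴴ)) x i j| ≤ rV) ∧ (∀ j' x, scChi d L mv kk hL k x ≠ 0 → ∀ i, ∑ j, |tCoefA ((((L ^ kk : ℕ) : ℝ))⁻¹) (gaugePair (scShift d L mv kk hL) fun μ y => coordMat e (ContinuousLinearMap.mulLeftRight ℝ (Matrix mm mm ℂ) (w y * (U μ y : Matrix mm mm ℂ) * (w (scShift d L mv kk hL μ y))ᴴ)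 (w y * (U μ y : Matrix mm mm ℂ) * (w (scShift d L mv kk hL μ y))ᴴ)ᴴ)) j' x i j| ≤ rV) := fun k hk =>
    uN_exists_gauge_cutCoefLetters_of_reg335Cube e (scShift d L mv kk hL) U he hη hU hξ hC.le (hfar k hk) (fun x hx => scChi_ne_zero_nbhd hL hL7 mv kk k x hx) hrA hrC
  choose wf hwfu hwfC hwfA using hfarW
  -- NEAR cubes: the letters in the trivial gauge (dag-n15-w2's letters of a (3.35) datum, `u = 1`, `w = 1`)
  have hnearL : ∀ k, ¬Far k → (∀ x, scChi d L mv kk hL k x ≠ 0 → ∀ i, ∑ j, |tCoefC ((((L ^ kk : ℕ) : ℝ))⁻¹) (gaugePair (scShift d L mv kk hL) fun μ y => coordMat e (ContinuousLinearMap.mulLeftRight ℝ (Matrix mm mm ℂ) ((fun _ => (1 : Matrix mm mm ℂ)) y * (U μ y : Matrix mm mm ℂ) * ((fun _ => (1 : Matrix mm mm ℂ)) (scShift d L mv kk hL μ y))ᴴ) ((fun _ => (1 : Matrix mm mm ℂ)) y * (U μ y : Matrix mm mm ℂ) * ((fun _ => (1 : Matrix mm mm ℂ)) (scShift d L mv kk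 hL μ y))ᴴ)ᴴ)) x i j| ≤ rV) ∧ (∀ j' x, scChi d L mv kk hL k x ≠ 0 → ∀ i, ∑ j, |tCoefA ((((L ^ kk : ℕ) : ℝ))⁻¹) (gaugePair (scShift d L mv kk hL) fun μ y => coordMat e (ContinuousLinearMap.mulLeftRight ℝ (Matrix mm mm ℂ) ((fun _ => (1 : Matrix mm mm ℂ)) y * (U μ y : Matrix mm mm ℂ) * ((fun _ => (1 : Matrix mm mm ℂ)) (scShift d L mv kk hL μ y))ᴴ) ((fun _ => (1 : Matrix mm mm ℂ)) y * (U μ y : Matrix mm mm ℂ) * ((fun _ => (1 : Matrix mm mm ℂ)) (scShift d L mv kk hL μ y))ᴴ)ᴴ)) j' x i j| ≤ rV) := fun k hk => by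
    obtain ⟨A, hg, hA, hD⟩ := hnear k hk
    have key := fun x (hx : scChi d L mv kk hL k x ≠ 0) =>
      uN_localCoefLetters_of_gauge335 e (scShift d L mv kk hL) U he hη hU hξ hC.le (fun z _ => hone z) hg hA hD (w := fun _ => (1 : Matrix mm mm ℂ))
        (fun _ => by rw [Matrix.conjTranspose_one, one_mul]) (fun z _ => Units.val_one.symm) (scChi_ne_zero_nbhd hL hL7 mv kk k x hx).1 (scChi_ne_zero_nbhd hL hL7 mv kk k x hx).2.1
        (scChi_ne_zero_nbhd hL hL7 mv kk k x hx).2.2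
    exact ⟨fun x hx i => ((key x hx).2 i).trans hrC, fun j' x hx i => ((key x hx).1 j' i).trans hrA⟩
  -- the FLAT field: letters of the trivial datum (`U = 1`, `u = 1`, `A = 0`)
  have hflatL : ∀ k : Fin (d + 1) → ZMod (2 * L), (∀ x, scChi d L mv kk hL k x ≠ 0 → ∀ i, ∑ j, |tCoefC ((((L ^ kk : ℕ) : ℝ))⁻¹) (gaugePair (scShift d L mv kk hL) fun μ y => coordMat e (ContinuousLinearMap.mulLeftRight ℝ (Matrix mm mm ℂ) ((fun _ => (1 : Matrix mm mm ℂ)) y * ((fun _ _ => (1 : (Matrix mm mm ℂ)ˣ)) μ y : Matrix mm mm ℂ) * ((fun _ => (1 : Matrix mm mm ℂ)) (scShift d L mv kk hL μ y))ᴴ) ((fun _ => (1 : Matrix mm mm ℂ)) y * ((fun _ _ => (1 : (Matrix mm mm ℂ)ˣ)) μ y : Matrix mm mm ℂ) * ((fun _ => (1 : Matrix mm mm ℂ)) (scShift d L mv kk hL μ y))ᴴ)ᴴ)) x i j| ≤ rV) ∧ (∀ j' x, scChi d L mv kk hL k x ≠ 0 → ∀ i, ∑ j, |tCoefA ((((L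 ^ kk : ℕ) : ℝ))⁻¹) (gaugePair (scShift d L mv kk hL) fun μ y => coordMat e (ContinuousLinearMap.mulLeftRight ℝ (Matrix mm mm ℂ) ((fun _ => (1 : Matrix mm mm ℂ)) y * ((fun _ _ => (1 : (Matrix mm mm ℂ)ˣ)) μ y : Matrix mm mm ℂ) * ((fun _ => (1 : Matrix mm mm ℂ)) (scShift d L mv kk hL μ y))ᴴ) ((fun _ => (1 : Matrix mm mm ℂ)) y * ((fun _ _ => (1 : (Matrix mm mm ℂ)ˣ)) μ y : Matrix mm mm ℂ) * ((fun _ => (1 : Matrix mm mm ℂ)) (scShift d L mv kk hL μ y))ᴴ)ᴴ)) j' x i j| ≤ rV) := fun k => by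
    have hg : ∀ μ, ∀ z ∈ {x : ScX d L mv kk hL | blockOf (L ^ kk) (cvM d L mv kk hL) x ∈ cubeBlocks (cvM d L mv kk hL) (coverCorner (cvM d L mv kk hL) (L ^ mv) L (2 * L ^ mv + 1) k) (6 * L ^ mv + 3)}, gaugeTr (scShift d L mv kk hL) (fun _ => (1 : (Matrix mm mm ℂ)ˣ)) (fun _ _ => (1 : (Matrix mm mm ℂ)ˣ)) μ z = fluct ((((L ^ kk : ℕ) : ℝ))⁻¹) (0 : Fin (d + 1) → ScX d L mv kk hL → Matrix mm mm ℂ) μ z :=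
      fun μ z _ => by rw [fluct_zero, gaugeTr_apply, inv_one, mul_one, mul_one]
    have hA : ∀ μ, ∀ z ∈ {x : ScX d L mv kk hL | blockOf (L ^ kk) (cvM d L mv kk hL) x ∈ cubeBlocks (cvM d L mv kk hL) (coverCorner (cvM d L mv kk hL) (L ^ mv) L (2 * L ^ mv + 1) k) (6 * L ^ mv + 3)}, ‖(0 : Fin (d + 1) → ScX d L mv kk hL → Matrix mm mm ℂ) μ z‖ < C * ξ⁻¹ := fun μ z _ => by
      rw [Pi.zero_apply, Pi.zero_apply, norm_zero]; exact mul_pos hC (inv_pos.2 hξ)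
    have hD : ∀ μ ν, ∀ z ∈ {x : ScX d L mv kk hL | blockOf (L ^ kk) (cvM d L mv kk hL) x ∈ cubeBlocks (cvM d L mv kk hL) (coverCorner (cvM d L mv kk hL) (L ^ mv) L (2 * L ^ mv + 1) k) (6 * L ^ mv + 3)}, ‖((↑((((L ^ kk : ℕ) : ℝ))⁻¹) : ℂ)⁻¹) • covD (scShift d L mv kk hL) (fun _ _ => (1 : (Matrix mm mm ℂ)ˣ)) μ ((0 : Fin (d + 1) → ScX d L mv kk hL → Matrix mm mm ℂ) ν) z‖ < C * (ξ ^ 2)⁻¹ :=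
      fun μ ν z _ => by rw [Pi.zero_apply, B9Eq335RegularityClasses.covD_zero, smul_zero, norm_zero]; exact mul_pos hC (inv_pos.2 (pow_pos hξ 2))
    have key := fun x (hx : scChi d L mv kk hL k x ≠ 0) =>
      uN_localCoefLetters_of_gauge335 e (scShift d L mv kk hL) (fun _ _ => (1 : (Matrix mm mm ℂ)ˣ)) he hη h1u hξ hC.le (fun z _ => hone z) hg hA hD (w := fun _ => (1 : Matrix mm mm ℂ))
        (fun _ => by rw [Matrix.conjTranspose_one, one_mul]) (fun z _ => Units.val_one.symm) (scChi_ne_zero_nbhd hL hL7 mv kk k x hx).1 (scChi_ne_zero_nbhd hL hL7 mv kk k x hx).2.1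
        (scChi_ne_zero_nbhd hL hL7 mv kk k x hx).2.2
    exact ⟨fun x hx i => ((key x hx).2 i).trans hrC, fun j' x hx i => ((key x hx).1 j' i).trans hrA⟩
  -- the first knit's gauges: the class's on the far cubes, `1` on the near ones
  have hwu : ∀ k x, ((fun k => if hk : Far k then wf k hk else fun _ => (1 : Matrix mm mm ℂ)) k x)ᴴ * (fun k => if hk : Far k then wf k hk else fun _ => (1 : Matrix mm mm ℂ)) k x = 1 := fun k x => by
    by_cases hk : Far k
    · simp only [dif_pos hk]; exact hwfu k hk x
    · simp only [dif_neg hk]; rw [Matrix.conjTranspose_one, one_mul]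
  have h1w : ∀ (k : Fin (d + 1) → ZMod (2 * L)) (x : ScX d L mv kk hL), ((fun (_ : Fin (d + 1) → ZMod (2 * L)) (_ : ScX d L mv kk hL) => (1 : Matrix mm mm ℂ)) k x)ᴴ * (fun (_ : Fin (d + 1) → ZMod (2 * L)) (_ : ScX d L mv kk hL) => (1 : Matrix mm mm ℂ)) k x = 1 := fun k x => by rw [Matrix.conjTranspose_one, one_mul]
  have hCw : ∀ k, ∀ x, scChi d L mv kk hL k x ≠ 0 → ∀ i, ∑ j, |tCoefC ((((L ^ kk : ℕ) : ℝ))⁻¹) (gaugePair (scShift d L mv kk hL) fun μ y => coordMat e (ContinuousLinearMap.mulLeftRight ℝ (Matrix mm mm ℂ) ((fun k => if hk : Far k then wf k hk else fun _ => (1 : Matrix mm mm ℂ)) k y * (U μ y : Matrix mm mm ℂ) * ((fun k => if hk : Far k then wf k hk else fun _ => (1 : Matrix mm mm ℂ)) k (scShift d L mv kk hL μ y))ᴴ) ((fun k => if hk : Far k then wf k hk else fun _ => (1 : Matrix mm mm ℂ)) k y * (U μ y : Matrix mm mm ℂ) * ((fun k => if hk : Far k then wf k hk else fun _ => (1 :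 Matrix mm mm ℂ)) k (scShift d L mv kk hL μ y))ᴴ)ᴴ)) x i j| ≤ rV := fun k => by
    by_cases hk : Far k
    · simp only [dif_pos hk]; exact hwfC k hk
    · simp only [dif_neg hk]; exact (hnearL k hk).1
  have hAw : ∀ k, ∀ j' x, scChi d L mv kk hL k x ≠ 0 → ∀ i, ∑ j, |tCoefA ((((L ^ kk : ℕ) : ℝ))⁻¹) (gaugePair (scShift d L mv kk hL) fun μ y => coordMat e (ContinuousLinearMap.mulLeftRight ℝ (Matrix mm mm ℂ) ((fun k => if hk : Far k then wf k hk else fun _ => (1 : Matrix mm mm ℂ)) k y * (U μ y : Matrix mm mm ℂ) * ((fun k => if hk : Far k then wf k hk else fun _ => (1 : Matrix mm mm ℂ)) k (scShift d L mv kk hL μ y))ᴴ) ((fun k => if hk : Far k then wf k hk else fun _ => (1 : Matrix mm mm ℂ)) k y * (U μ y : Matrix mm mm ℂ) * ((fun k => if hk : Far k then wf k hk else fun _ => (1 : Matrix mm mm ℂ)) k (scShift d L mv kk hL μ y))ᴴ)ᴴ)) j' x i j| ≤ rV := fun k => by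
    by_cases hk : Far k
    · simp only [dif_pos hk]; exact hwfA k hk
    · simp only [dif_neg hk]; exact (hnearL k hk).2
  have key := H mv kk hk hw₀' e he Far Z dZ hdZ hdZ0 hZ (fun k => if hk : Far k then wf k hk else fun _ => 1) (fun (_ : Fin (d + 1) → ZMod (2 * L)) (_ : ScX d L mv kk hL) => (1 : Matrix mm mm ℂ)) hwu h1w (fun k hk => by simp only [dif_neg hk])
    (fun μ x => (U μ x : Matrix mm mm ℂ)) (fun (_ : Fin (d + 1)) (_ : ScX d L mv kk hL) => ((1 : (Matrix mm mm ℂ)ˣ) : Matrix mm mm ℂ)) (scP d L mv kk hL (aK a₀ (L : ℝ) kk * (((L ^ kk : ℕ) : ℝ)) ^ (d + 1)) ι e (fun μ x => (U μ x : Matrix mm mm ℂ))) (scP d L mv kk hL (aK a₀ (L : ℝ) kk * (((L ^ kk : ℕ) : ℝ)) ^ (d + 1)) ι e (fun (_ : Fin (d + 1)) (_ : ScX d L mv kk hL) => ((1 : (Matrix mm mm ℂ)ˣ) : Matrix mm mm ℂ)))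
    (scNV d L mv kk hL (aK a₀ (L : ℝ) kk * (((L ^ kk : ℕ) : ℝ)) ^ (d + 1)) ι e (fun k => if hk : Far k then wf k hk else fun _ => 1) (fun μ x => (U μ x : Matrix mm mm ℂ))) (scNV d L mv kk hL (aK a₀ (L : ℝ) kk * (((L ^ kk : ℕ) : ℝ)) ^ (d + 1)) ι e (fun (_ : Fin (d + 1) → ZMod (2 * L)) (_ : ScX d L mv kk hL) => (1 : Matrix mm mm ℂ)) (fun (_ : Fin (d + 1)) (_ : ScX d L mv kk hL) => ((1 : (Matrix mm mm ℂ)ˣ) : Matrix mm mm ℂ))) rV (aK a₀ (L : ℝ) kk * (Fintype.card ι * (Fintype.card ι * ((1 + rV * ((((L ^ kk : ℕ) : ℝ))⁻¹)) ^ ((d + 1) * L ^ kk) - 1) ^ 2 + 2 * ((1 + rV * ((((L ^ kk : ℕ) : ℝ))⁻¹)) ^ ((d + 1) * L ^ kk) - 1)))) 0 hrV hRN0 le_rfl hRle' hθ₀.le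
    (fun k => scP_conj ι e (aK a₀ (L : ℝ) kk * (((L ^ kk : ℕ) : ℝ)) ^ (d + 1)) (fun k => if hk : Far k then wf k hk else fun _ => 1) (fun μ x => (U μ x : Matrix mm mm ℂ)) k) (fun k => hCw k) (fun k => hAw k)
    (fun k => (hasMaj_scNV_cut_of_rows ι e he (aK a₀ (L : ℝ) kk * (((L ^ kk : ℕ) : ℝ)) ^ (d + 1)) hwu (fun μ x => (U μ x : Matrix mm mm ℂ)) hrV k (fun μ x hx i => hAw k (Sum.inl μ) x hx i) δ).mono fun y y' =>
      mul_le_mul_of_nonneg_right (le_of_eq (by rw [habs])) (Real.exp_nonneg _))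
    (fun k => by
      rw [one_sub_scPsi_comp_scNV_comp_scChi ι e he hM hm₁ hfitI hS0 (aK a₀ (L : ℝ) kk * (((L ^ kk : ℕ) : ℝ)) ^ (d + 1)) hwu (fun μ x => (U μ x : Matrix mm mm ℂ)) k]
      exact (hasMaj_zero _ _).mono fun y y' => by positivity)
    (fun k => scP_conj ι e (aK a₀ (L : ℝ) kk * (((L ^ kk : ℕ) : ℝ)) ^ (d + 1)) (fun (_ : Fin (d + 1) → ZMod (2 * L)) (_ : ScX d L mv kk hL) => (1 : Matrix mm mm ℂ)) (fun (_ : Fin (d + 1)) (_ : ScX d L mv kk hL) => ((1 : (Matrix mm mm ℂ)ˣ) : Matrix mm mm ℂ)) k) (fun k => (hflatL k).1) (fun k => (hflatL k).2)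
    (fun k => (hasMaj_scNV_cut_of_rows ι e he (aK a₀ (L : ℝ) kk * (((L ^ kk : ℕ) : ℝ)) ^ (d + 1)) h1w (fun (_ : Fin (d + 1)) (_ : ScX d L mv kk hL) => ((1 : (Matrix mm mm ℂ)ˣ) : Matrix mm mm ℂ)) hrV k (fun μ x hx i => (hflatL k).2 (Sum.inl μ) x hx i) δ).mono fun y y' =>
      mul_le_mul_of_nonneg_right (le_of_eq (by rw [habs])) (Real.exp_nonneg _))
    (fun k => by
      rw [one_sub_scPsi_comp_scNV_comp_scChi ι e he hM hm₁ hfitI hS0 (aK a₀ (L : ℝ) kk * (((L ^ kk : ℕ) : ℝ)) ^ (d + 1)) h1w (fun (_ : Fin (d + 1)) (_ : ScX d L mv kk hL) => ((1 : (Matrix mm mm ℂ)ˣ) : Matrix mm mm ℂ)) k]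
      exact (hasMaj_zero _ _).mono fun y y' => by positivity)
  -- both knits invert their operators (n15-c∕262), hence are the named Green's functions (n15-c∕266)
  have h1U : ∀ (μ : Fin (d + 1)) (x : ScX d L mv kk hL), ((fun (_ : Fin (d + 1)) (_ : ScX d L mv kk hL) => ((1 : (Matrix mm mm ℂ)ˣ) : Matrix mm mm ℂ)) μ x)ᴴ * (fun (_ : Fin (d + 1)) (_ : ScX d L mv kk hL) => ((1 : (Matrix mm mm ℂ)ˣ) : Matrix mm mm ℂ)) μ x = 1 := fun μ x => by
    simp only [Units.val_one, Matrix.conjTranspose_one, one_mul]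
  obtain ⟨-, hleft₁, -⟩ := Hq mv kk hk hw₀q e he (fun k => if hk : Far k then wf k hk else fun _ => 1) hwu (fun μ x => (U μ x : Matrix mm mm ℂ)) (scP d L mv kk hL (aK a₀ (L : ℝ) kk * (((L ^ kk : ℕ) : ℝ)) ^ (d + 1)) ι e (fun μ x => (U μ x : Matrix mm mm ℂ)))
    (scNV d L mv kk hL (aK a₀ (L : ℝ) kk * (((L ^ kk : ℕ) : ℝ)) ^ (d + 1)) ι e (fun k => if hk : Far k then wf k hk else fun _ => 1) (fun μ x => (U μ x : Matrix mm mm ℂ))) rV (aK a₀ (L : ℝ) kk * (Fintype.card ι * (Fintype.card ι * ((1 + rV * ((((L ^ kk : ℕ) : ℝ))⁻¹)) ^ ((d + 1) * L ^ kk) - 1) ^ 2 + 2 * ((1 + rV * ((((L ^ kk : ℕ) : ℝ))⁻¹)) ^ ((d + 1) * L ^ kk) - 1)))) 0 hrV hRN0 le_rfl hRleq hθ₀q.le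
    (fun k => scP_conj ι e (aK a₀ (L : ℝ) kk * (((L ^ kk : ℕ) : ℝ)) ^ (d + 1)) (fun k => if hk : Far k then wf k hk else fun _ => 1) (fun μ x => (U μ x : Matrix mm mm ℂ)) k) (fun k => hCw k) (fun k => hAw k)
    (fun k => (hasMaj_scNV_cut_of_rows ι e he (aK a₀ (L : ℝ) kk * (((L ^ kk : ℕ) : ℝ)) ^ (d + 1)) hwu (fun μ x => (U μ x : Matrix mm mm ℂ)) hrV k (fun μ x hx i => hAw k (Sum.inl μ) x hx i) δq).mono fun y y' =>
      mul_le_mul_of_nonneg_right (le_of_eq (by rw [habs])) (Real.exp_nonneg _))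
    (fun k => by
      rw [one_sub_scPsi_comp_scNV_comp_scChi ι e he hM hm₁ hfitI hS0 (aK a₀ (L : ℝ) kk * (((L ^ kk : ℕ) : ℝ)) ^ (d + 1)) hwu (fun μ x => (U μ x : Matrix mm mm ℂ)) k]
      exact (hasMaj_zero _ _).mono fun y y' => by positivity)
  obtain ⟨-, hleft₂, -⟩ := Hq mv kk hk hw₀q e he (fun (_ : Fin (d + 1) → ZMod (2 * L)) (_ : ScX d L mv kk hL) => (1 : Matrix mm mm ℂ)) h1w (fun (_ : Fin (d + 1)) (_ : ScX d L mv kk hL) => ((1 : (Matrix mm mm ℂ)ˣ) : Matrix mm mm ℂ)) (scP d L mv kk hL (aK a₀ (L : ℝ) kk * (((L ^ kk : ℕ) : ℝ)) ^ (d + 1)) ι e (fun (_ : Fin (d + 1)) (_ : ScX d L mv kk hL) => ((1 : (Matrix mm mm ℂ)ˣ) : Matrix mm mm ℂ))) (scNV d L mv kk hL (aK a₀ (L : ℝ) kk * (((L ^ kk : ℕ) : ℝ)) ^ (d + 1)) ι e (fun (_ : Fin (d + 1) → ZMod (2 * L)) (_ : ScX d L mv kk hL) => (1 : Matrix mm mm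 ℂ)) (fun (_ : Fin (d + 1)) (_ : ScX d L mv kk hL) => ((1 : (Matrix mm mm ℂ)ˣ) : Matrix mm mm ℂ))) rV (aK a₀ (L : ℝ) kk * (Fintype.card ι * (Fintype.card ι * ((1 + rV * ((((L ^ kk : ℕ) : ℝ))⁻¹)) ^ ((d + 1) * L ^ kk) - 1) ^ 2 + 2 * ((1 + rV * ((((L ^ kk : ℕ) : ℝ))⁻¹)) ^ ((d + 1) * L ^ kk) - 1)))) 0 hrV hRN0 le_rfl hRleq hθ₀q.le
    (fun k => scP_conj ι e (aK a₀ (L : ℝ) kk * (((L ^ kk : ℕ) : ℝ)) ^ (d + 1)) (fun (_ : Fin (d + 1) → ZMod (2 * L)) (_ : ScX d L mv kk hL) => (1 : Matrix mm mm ℂ)) (fun (_ : Fin (d + 1)) (_ : ScX d L mv kk hL) => ((1 : (Matrix mm mm ℂ)ˣ) : Matrix mm mm ℂ)) k) (fun k => (hflatL k).1) (fun k => (hflatL k).2)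
    (fun k => (hasMaj_scNV_cut_of_rows ι e he (aK a₀ (L : ℝ) kk * (((L ^ kk : ℕ) : ℝ)) ^ (d + 1)) h1w (fun (_ : Fin (d + 1)) (_ : ScX d L mv kk hL) => ((1 : (Matrix mm mm ℂ)ˣ) : Matrix mm mm ℂ)) hrV k (fun μ x hx i => (hflatL k).2 (Sum.inl μ) x hx i) δq).mono fun y y' =>
      mul_le_mul_of_nonneg_right (le_of_eq (by rw [habs])) (Real.exp_nonneg _))
    (fun k => by
      rw [one_sub_scPsi_comp_scNV_comp_scChi ι e he hM hm₁ hfitI hS0 (aK a₀ (L : ℝ) kk * (((L ^ kk : ℕ) : ℝ)) ^ (d + 1)) h1w (fun (_ : Fin (d + 1)) (_ : ScX d L mv kk hL) => ((1 : (Matrix mm mm ℂ)ˣ) : Matrix mm mm ℂ)) k]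
      exact (hasMaj_zero _ _).mono fun y y' => by positivity)
  have hleft₁' : scGlued d L mv kk hL (aK a₀ (L : ℝ) kk * (((L ^ kk : ℕ) : ℝ)) ^ (d + 1)) ((((L ^ kk : ℕ) : ℝ))⁻¹) ι e (fun k => if hk : Far k then wf k hk else fun _ => 1) (fun μ x => (U μ x : Matrix mm mm ℂ)) (scP d L mv kk hL (aK a₀ (L : ℝ) kk * (((L ^ kk : ℕ) : ℝ)) ^ (d + 1)) ι e (fun μ x => (U μ x : Matrix mm mm ℂ))) (scNV d L mv kk hL (aK a₀ (L : ℝ) kk * (((L ^ kk : ℕ) : ℝ)) ^ (d + 1)) ι e (fun k => if hk : Far k then wf k hk else fun _ => 1) (fun μ x => (U μ x : Matrix mm mm ℂ))) ∘ₗ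
      Matrix.mulVecLin (claplA (cvM d L mv kk hL) (L ^ kk) (cvT e (fun μ x => (U μ x : Matrix mm mm ℂ))) (aK a₀ (L : ℝ) kk * (((L ^ kk : ℕ) : ℝ)) ^ (d + 1))) = LinearMap.id := by
    rw [← covLapM_add_scP_eq_mulVecLin_claplA ι e he (aK a₀ (L : ℝ) kk * (((L ^ kk : ℕ) : ℝ)) ^ (d + 1)) (fun μ x => (U μ x : Matrix mm mm ℂ)) hU']; exact hleft₁
  have hleft₂' : scGlued d L mv kk hL (aK a₀ (L : ℝ) kk * (((L ^ kk : ℕ) : ℝ)) ^ (d + 1)) ((((L ^ kk : ℕ) : ℝ))⁻¹) ι e (fun (_ : Fin (d + 1) → ZMod (2 * L)) (_ : ScX d L mv kk hL) => (1 : Matrix mm mm ℂ)) (fun (_ : Fin (d + 1)) (_ : ScX d L mv kk hL) => ((1 : (Matrix mm mm ℂ)ˣ) : Matrix mm mm ℂ)) (scP d L mv kk hL (aK a₀ (L : ℝ) kk * (((L ^ kk : ℕ) : ℝ)) ^ (d + 1)) ι e (fun (_ : Fin (d + 1)) (_ : ScX d L mv kk hL) => ((1 : (Matrix mm mm ℂ)ˣ)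 : Matrix mm mm ℂ))) (scNV d L mv kk hL (aK a₀ (L : ℝ) kk * (((L ^ kk : ℕ) : ℝ)) ^ (d + 1)) ι e (fun (_ : Fin (d + 1) → ZMod (2 * L)) (_ : ScX d L mv kk hL) => (1 : Matrix mm mm ℂ)) (fun (_ : Fin (d + 1)) (_ : ScX d L mv kk hL) => ((1 : (Matrix mm mm ℂ)ˣ) : Matrix mm mm ℂ))) ∘ₗ Matrix.mulVecLin (claplA (cvM d L mv kk hL) (L ^ kk) (cvT e (fun (_ : Fin (d + 1)) (_ : ScX d L mv kk hL) => ((1 : (Matrix mm mm ℂ)ˣ) : Matrix mm mm ℂ))) (aK a₀ (L : ℝ) kk * (((L ^ kk : ℕ) : ℝ)) ^ (d + 1))) = LinearMap.id := by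
    rw [← covLapM_add_scP_eq_mulVecLin_claplA ι e he (aK a₀ (L : ℝ) kk * (((L ^ kk : ℕ) : ℝ)) ^ (d + 1)) (fun (_ : Fin (d + 1)) (_ : ScX d L mv kk hL) => ((1 : (Matrix mm mm ℂ)ˣ) : Matrix mm mm ℂ)) h1U]; exact hleft₂
  rw [eq_mulVecLin_cGreen_of_comp_eq_id (isUnit_cvT ι e he (fun μ x => (U μ x : Matrix mm mm ℂ)) hU') ha' hleft₁', eq_mulVecLin_cGreen_of_comp_eq_id (isUnit_cvT ι e he (fun (_ : Fin (d + 1)) (_ : ScX d L mv kk hL) => ((1 : (Matrix mm mm ℂ)ˣ) : Matrix mm mm ℂ)) h1U) ha' hleft₂',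
    show (fun (_ : Fin (d + 1)) (_ : ScX d L mv kk hL) => ((1 : (Matrix mm mm ℂ)ˣ) : Matrix mm mm ℂ)) = fun _ _ => (1 : Matrix mm mm ℂ) from funext fun _ => funext fun _ => Units.val_one, cvT_one e] at key
  exact key.mono fun y y' => le_of_eq (by ring)

end Green

end Summit.QuantumFields.YangMills.BalabanUVNodes.N15.Gluing

end
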